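import Mathlib
import Summits.KontsevichZagierPeriods.KontsevichZagierPeriods.Theses.TorsionLogs
import Summits.KontsevichZagierPeriods.KontsevichZagierPeriods.Theorems.TorsionLogsNeronTorsionSectorAssemblyMain

/-!
# F3 — specialisation evidence for the rung `NeronDuplicationChain`

FLOOR (`g1-KontsevichZagierPeriods-17981`): `TorsionLogs.NeronTorsionPrimitiveChain`, proved by
`Cruxes.NeronTorsionSector.Translation.stub_assembly` (axiom-clean).  The rung replaces the floor's
torsion hypothesis `addOrderOf P = N` (which makes the translation orbit of `P` a finite grid and the
ratio `u_P/ω₁` rational) by an ARBITRARY point `P` of the identity component together with its double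
`2P` (tangent abscissa `x_R`), and pins the log carrier: `B ^ c = f(x_P)² / D³`, `D = 3e₁² − g₂/4`.

Honest containment statement (brief F3): the floor is NOT a literal `simpa` instance of the rung — the
torsion case is the DEGENERATE member of the multiplication family (`ψ_N(P) = 0`), where the Néron value
`log|ψ_N(P)|` is replaced by the finite translation average.  What IS literal:
* (1) below: the floor theorem, by name, at the floor item's type (the BC5/T3 witness);
* (2) below: at a FLEX (`16·ψ₃(x_P) = (12x_P² − g₂)² − 48·x_P·f(x_P) = 0`) the rung's tangent abscissa is
  `x_R = x_P` (so `rJ := rI`), i.e. the open crux `TorsionLogs.NeronTorsionFlex` (3-torsion, curve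
  `g₂ = 28, g₃ = −24`, `e₁ = 2`) is the rung's fixed-point member; the kernel-checked composition
  `NeronTorsionFlex_of : NeronDuplicationChain → FlexTorsionProduct → NeronTorsionFlex` is in
  `Lines/NeronDuplication.lean` (coefficients `36 = −3·(4 − 16)`, `1 = −3·(−3) + 4·(−2)… ` see there);
* (3) below: the coefficient bookkeeping of that composition as a `ring` identity.
-/

namespace Summit.KontsevichZagierPeriods.KontsevichZagierPeriods.Cruxes.NeronTorsionFlex.NeronDuplication

open Summit.KontsevichZagierPeriods.KontsevichZagierPeriods

/-- (1) The floor, by name (witness of weakness for the ladder; lies outside `S`'s known regime: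
no case of `KontsevichZagierPeriods` is a theorem in the tree). -/
example : Theses.TorsionLogs.NeronTorsionPrimitiveChain :=
  Cruxes.NeronTorsionSector.Translation.stub_assembly

/-- (2) At a flex of `y² = 4x³ − g₂x − g₃` (i.e. `16ψ₃(x) = (12x² − g₂)² − 48x·f(x) = 0`, `f(x) ≠ 0`)
the tangent-line abscissa of `2P` equals `x_P`: the rung's `x_R` collapses to `x_P`. -/
theorem tangent_abscissa_eq_self_of_flex (g₂ g₃ x : ℝ) (hf : 4 * x ^ 3 - g₂ * x - g₃ ≠ 0)
    (hψ : (12 * x ^ 2 - g₂) ^ 2 - 48 * x * (4 * x ^ 3 - g₂ * x - g₃) = 0) :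
    (12 * x ^ 2 - g₂) ^ 2 / (16 * (4 * x ^ 3 - g₂ * x - g₃)) - 2 * x = x := by
  rw [sub_eq_iff_eq_add, div_eq_iff (by positivity)]
  linear_combination hψ

/-- (2') The flex quartic of the route's curve `g₂ = 28, g₃ = −24` is `16ψ₃/…`: precisely,
`(12x² − 28)² − 48x(4x³ − 28x + 24) = −16·(3x⁴ − 42x² + 72x − 49)`. -/
example (x : ℝ) :
    (12 * x ^ 2 - 28) ^ 2 - 48 * x * (4 * x ^ 3 - 28 * x + 24)
      = -16 * (3 * x ^ 4 - 42 * x ^ 2 + 72 * x - 49) := by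
  ring

/-- (3) Coefficient bookkeeping of `NeronTorsionFlex_of`: with `rJ = rI` the rung gives
`(4 − 16)[rI] + 4[rU] − 3[rP] + c[rB]`, the support stub gives `3[rU] − 2[rP]`, the interval-log
relation gives `c[rB] − [rL]·(…)`; the combination `−3·rung + 4·product + 3·log` has coefficients
`36, 0, 1, −3c, …` on `[rI], [rU], [rP], [rB]`. -/
example (c : ℤ) :
    (-3 : ℤ) * (4 - 16) = 36 ∧ (-3 : ℤ) * 4 + 4 * 3 = 0 ∧ (-3 : ℤ) * (-3) + 4 * (-2) = 1 ∧
      (-3 : ℤ) * c + 3 * c = 0 := by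
  refine ⟨by norm_num, by norm_num, by norm_num, by ring⟩

end Summit.KontsevichZagierPeriods.KontsevichZagierPeriods.Cruxes.NeronTorsionFlex.NeronDuplication
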